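import Mathlib
import Summits.KontsevichZagierPeriods.Zeta5Search.BrickPartialFractions
import Summits.KontsevichZagierPeriods.Zeta5Search.BrickLaurentValuation

/-!
# BrickRegularCoefficients — the REGULAR Taylor coefficients `[T^{A+C}]F_m` of the brick kernels through the cells:
`[T^{A+C}]F_m = (−1)^C Σ_{K≠m} Σ_{s=1}^{A} binom(s+C−1, C)·c_{K,s}·(K−m)^{−(s+C)}` (cell `pub-zeta5`, seat ct-1 g45)

HONEST FRAMING: systematic search; no irrationality claim unless certified.  PURE ALGEBRA in `ℚ⟦T⟧` about the local power
series `F_m(T) = T^A·R_n(T − m)` (`BrickLaurent.laurentSeries A B ε n m`) of the brick kernels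
`R_n(t) = n!^{A−2B}(t + n/2)^ε∏_{j=1}^{n}(t−j)^B∏_{j=1}^{n}(t+n+j)^B/∏_{k=0}^{n}(t+k)^A`: its coefficients of index `d ≤ A` are the
partial-fraction cells `c_{m,s} = [T^{A−s}]F_m` (`BrickLaurent.cell`), and its coefficients of index `d = A + C ≥ A` — the Taylor
coefficients of the REGULAR part of `R_n` at the pole `−m` — are read off the partial-fraction decomposition
`R_n = Σ_K Σ_s c_{K,s}(t+K)^{−s}` (`BrickPartialFractions.kerNum_eq_sum`) expanded at `t = −m`:
`(t+K)^{−s} = Σ_j (−1)^j binom(s+j−1, j)(K−m)^{−(s+j)}(t+m)^j`.  Nothing here is about `ζ(5)`; no `γ` / record statement.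
CONSUMER: ct-1 g45's `BrickTwistedConstantTerm` (for odd `C` Krattenthaler–Rivoal's constant term `p_{0,C,n}(1)` is
`−½Σ_m[T^{A+C}]F_m`) and `BrickDenominatorsOddC`.  Theorems only (0 `def`).

* `coeff_geom_pow` — `[T^j](geom y)^{d+1} = (−y)^j·binom(d+j, d)` (`geom y = Σ_k(−y)^kT^k`, `BrickLaurentValuation`);
* `inv_coe_X_add_C_pow`, `coeff_inv_coe_X_add_C_pow` — `((T + c)^s)^{−1} = c^{−s}·(geom c^{−1})^s` in `ℚ⟦T⟧` and its coefficients;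
* `expandAt_finset_sum` — linearity of `BrickLaurent.expandAt` in the numerator;
* `expandAt_self_term`, `expandAt_other_term` — the summands of `kerNum = Σ_K PP_K·kerDenErase_K` expanded at `−m`;
* **`laurent_regular_eq`** — for `2B ≤ A`, `ε < A`, `m ≤ n`, every `C`:
  `laurent A B ε n m (A + C) = Σ_{K≤n, K≠m} Σ_{s∈[1,A]} cell A B ε n K s·((K−m)^{−1})^s·((−(K−m)^{−1})^C·binom(s−1+C, s−1))`,
  and `laurent_regular_eq'` — the same with `(−1)^C·binom(s+C−1, C)/(K−m)^{s+C}`.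
-/

namespace Summit.KontsevichZagierPeriods.Zeta5Search.BrickRegularCoefficients

open Finset Nat Polynomial
open Summit.KontsevichZagierPeriods.Zeta5Search.BrickLaurent (expandAt laurentSeries laurent cell kerNum kerDenErase
  eval_kerDenErase_neg_ne_zero expandAt_eq_of_mul_eq constantCoeff_coe_taylor)
open Summit.KontsevichZagierPeriods.Zeta5Search.BrickPartialFractions (principalPoly kerNum_eq_sum)
open Summit.KontsevichZagierPeriods.Zeta5Search.BrickLaurentValuation (lin geom coe_X_add_C lin_inv constantCoeff_lin)

noncomputable section

/-! ## Power series: `((T + c)^s)^{−1}` and its coefficients -/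

/-- `[T^j](geom y)^{d+1} = (−y)^j·binom(d+j, d)` (`geom y = Σ_k (−y)^kT^k = rescale (−y) (Σ_k T^k)`, Mathlib's
`PowerSeries.mk_one_pow_eq_mk_choose_add`). -/
theorem coeff_geom_pow (y : ℚ) (d j : ℕ) :
    PowerSeries.coeff j (geom y ^ (d + 1)) = (-y) ^ j * (Nat.choose (d + j) d : ℚ) := by
  have h : geom y = PowerSeries.rescale (-y) (PowerSeries.mk 1) := by
    ext k
    rw [geom, PowerSeries.coeff_mk, PowerSeries.coeff_rescale, PowerSeries.coeff_mk, Pi.one_apply, mul_one]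
  rw [h, ← map_pow, PowerSeries.mk_one_pow_eq_mk_choose_add, PowerSeries.coeff_rescale, PowerSeries.coeff_mk]

/-- `(T + c)^s · (c^{−s}·(geom c^{−1})^s) = 1` in `ℚ⟦T⟧` (`c ≠ 0`). -/
theorem coe_X_add_C_pow_mul {c : ℚ} (hc : c ≠ 0) (s : ℕ) :
    (((X + C c) ^ s : ℚ[X]) : PowerSeries ℚ) * (PowerSeries.C (c⁻¹ ^ s) * geom c⁻¹ ^ s) = 1 := by
  have h1 : lin c * geom c⁻¹ = 1 := by
    rw [← lin_inv]; exact PowerSeries.mul_inv_cancel _ (by rw [constantCoeff_lin]; exact one_ne_zero)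
  rw [Polynomial.coe_pow, coe_X_add_C hc, mul_pow, ← map_pow]
  calc PowerSeries.C (c ^ s) * lin c ^ s * (PowerSeries.C (c⁻¹ ^ s) * geom c⁻¹ ^ s)
      = PowerSeries.C (c ^ s * c⁻¹ ^ s) * (lin c * geom c⁻¹) ^ s := by rw [map_mul, mul_pow]; ring
    _ = 1 := by rw [h1, one_pow, mul_one, ← mul_pow, mul_inv_cancel₀ hc, one_pow, map_one]

/-- The constant coefficient of `(T + c)^s` is `c^s`. -/
theorem constantCoeff_coe_X_add_C_pow (c : ℚ) (s : ℕ) :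
    PowerSeries.constantCoeff (((X + C c) ^ s : ℚ[X]) : PowerSeries ℚ) = c ^ s := by
  rw [Polynomial.constantCoeff_coe, Polynomial.coeff_zero_eq_eval_zero]
  simp

/-- **`((T + c)^s)^{−1} = c^{−s}·(geom c^{−1})^s`** in `ℚ⟦T⟧` (`c ≠ 0`). -/
theorem inv_coe_X_add_C_pow {c : ℚ} (hc : c ≠ 0) (s : ℕ) :
    ((((X + C c) ^ s : ℚ[X]) : PowerSeries ℚ))⁻¹ = PowerSeries.C (c⁻¹ ^ s) * geom c⁻¹ ^ s := by
  rw [PowerSeries.inv_eq_iff_mul_eq_one (by rw [constantCoeff_coe_X_add_C_pow]; exact pow_ne_zero _ hc), mul_comm]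
  exact coe_X_add_C_pow_mul hc s

/-- **`[T^j]((T + c)^s)^{−1} = c^{−s}·((−c^{−1})^j·binom(s−1+j, s−1))`** (`c ≠ 0`, `1 ≤ s`). -/
theorem coeff_inv_coe_X_add_C_pow {c : ℚ} (hc : c ≠ 0) {s : ℕ} (hs : 1 ≤ s) (j : ℕ) :
    PowerSeries.coeff j ((((X + C c) ^ s : ℚ[X]) : PowerSeries ℚ))⁻¹ =
      c⁻¹ ^ s * ((-c⁻¹) ^ j * (Nat.choose (s - 1 + j) (s - 1) : ℚ)) := by
  obtain ⟨d, rfl⟩ : ∃ d, s = d + 1 := ⟨s - 1, by omega⟩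
  rw [inv_coe_X_add_C_pow hc, PowerSeries.coeff_C_mul, coeff_geom_pow, Nat.add_sub_cancel]

/-! ## The summands of `kerNum = Σ_K PP_K·kerDenErase_K`, expanded at `−m` -/

/-- Linearity of `expandAt` in the numerator. -/
theorem expandAt_finset_sum {ι : Type*} (S : Finset ι) (a : ℚ) (P : ι → ℚ[X]) (Q : ℚ[X]) :
    expandAt a (∑ i ∈ S, P i) Q = ∑ i ∈ S, expandAt a (P i) Q := by
  unfold expandAt
  rw [map_sum, show (((∑ i ∈ S, taylor a (P i) : ℚ[X])) : PowerSeries ℚ) =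
    ∑ i ∈ S, ((taylor a (P i) : ℚ[X]) : PowerSeries ℚ) from map_sum Polynomial.coeToPowerSeries.ringHom _ S,
    Finset.sum_mul]

/-- **The own principal part**: `PP_m·kerDenErase_m / kerDenErase_m` expanded at `−m` is the polynomial `Σ_{d<A}[T^d]F_m·T^d`. -/
theorem expandAt_self_term (A B ε n m : ℕ) :
    expandAt (-(m : ℚ)) (principalPoly A B ε n m * kerDenErase A n m) (kerDenErase A n m) =
      ((∑ d ∈ range A, C (laurent A B ε n m d) * X ^ d : ℚ[X]) : PowerSeries ℚ) := by
  rw [expandAt_eq_of_mul_eq (-(m : ℚ)) (P₂ := principalPoly A B ε n m) (Q₂ := 1) (by ring)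
    (eval_kerDenErase_neg_ne_zero A n m) (by rw [eval_one]; exact one_ne_zero)]
  unfold expandAt
  have h1 : (((taylor (-(m : ℚ)) (1 : ℚ[X]) : ℚ[X])) : PowerSeries ℚ) = 1 := by
    rw [taylor_one, Polynomial.coe_C, map_one]
  have htay : taylor (-(m : ℚ)) (principalPoly A B ε n m) = ∑ d ∈ range A, C (laurent A B ε n m d) * X ^ d := by
    rw [principalPoly, map_sum]
    refine Finset.sum_congr rfl fun d _ => ?_
    rw [taylor_mul, taylor_C, taylor_pow, map_add, taylor_X, taylor_C, C_neg, neg_add_cancel_right]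
  rw [h1, htay, show (1 : PowerSeries ℚ)⁻¹ = 1 from by
    rw [PowerSeries.inv_eq_iff_mul_eq_one (by rw [map_one]; exact one_ne_zero), one_mul], mul_one]

/-- `[T^{A+C}]` of the own principal part vanishes (`C ≥ 0`: it is a polynomial of degree `< A`). -/
theorem coeff_self_term (A B ε n m C : ℕ) :
    PowerSeries.coeff (A + C) (((∑ d ∈ range A, Polynomial.C (laurent A B ε n m d) * X ^ d : ℚ[X])) : PowerSeries ℚ) = 0 := by
  rw [Polynomial.coeff_coe, finsetSum_coeff]
  refine Finset.sum_eq_zero fun d hd => ?_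
  rw [coeff_C_mul, coeff_X_pow, if_neg (by have := mem_range.1 hd; omega), mul_zero]

/-- **Another pole's principal part**: for `K ≠ m` (both `≤ n`), `PP_K·kerDenErase_K / kerDenErase_m` expanded at `−m` is
`T^A · Σ_{d<A} [T^d]F_K · (T + (K−m))^d · ((T + (K−m))^A)^{−1}`. -/
theorem expandAt_other_term (A B ε : ℕ) {n m K : ℕ} (hm : m ≤ n) (hK : K ≤ n) (hKm : K ≠ m) :
    expandAt (-(m : ℚ)) (principalPoly A B ε n K * kerDenErase A n K) (kerDenErase A n m) =
      PowerSeries.X ^ A * ∑ d ∈ range A, PowerSeries.C (laurent A B ε n K d) *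
        ((((X + C ((K : ℚ) - m)) ^ d : ℚ[X]) : PowerSeries ℚ) * ((((X + C ((K : ℚ) - m)) ^ A : ℚ[X]) : PowerSeries ℚ))⁻¹) := by
  -- `kerDenErase_K = E·(X+m)^A`, `kerDenErase_m = E·(X+K)^A` with the common factor `E`
  set E : ℚ[X] := (∏ k ∈ ((range (n + 1)).erase K).erase m, (X + C (k : ℚ))) ^ A with hE
  have hmK : m ∈ (range (n + 1)).erase K := mem_erase.2 ⟨hKm.symm, mem_range.2 (by omega)⟩
  have hKm' : K ∈ (range (n + 1)).erase m := mem_erase.2 ⟨hKm, mem_range.2 (by omega)⟩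
  have hEK : kerDenErase A n K = E * (X + C (m : ℚ)) ^ A := by
    rw [kerDenErase, hE, ← mul_pow, Finset.prod_erase_mul _ _ hmK]
  have hEm : kerDenErase A n m = E * (X + C (K : ℚ)) ^ A := by
    rw [kerDenErase, hE, ← mul_pow, Finset.erase_right_comm, Finset.prod_erase_mul _ _ hKm']
  have hcK : ((K : ℚ) - m) ≠ 0 := sub_ne_zero.2 (by exact_mod_cast hKm)
  have hQ₂ : ((X + C (K : ℚ)) ^ A : ℚ[X]).eval (-(m : ℚ)) ≠ 0 := by
    rw [eval_pow, eval_add, eval_X, eval_C]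
    exact pow_ne_zero _ (by rw [neg_add_eq_sub]; exact hcK)
  rw [expandAt_eq_of_mul_eq (-(m : ℚ)) (P₂ := principalPoly A B ε n K * (X + C (m : ℚ)) ^ A)
    (Q₂ := (X + C (K : ℚ)) ^ A) (by rw [hEK, hEm]; ring) (eval_kerDenErase_neg_ne_zero A n m) hQ₂]
  unfold expandAt
  have htK : taylor (-(m : ℚ)) ((X + C (K : ℚ)) ^ A) = (X + C ((K : ℚ) - m)) ^ A := by
    rw [taylor_pow, map_add, taylor_X, taylor_C, C_neg, map_sub]; ring
  have htm : taylor (-(m : ℚ)) ((X + C (m : ℚ)) ^ A) = X ^ A := by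
    rw [taylor_pow, map_add, taylor_X, taylor_C, C_neg, neg_add_cancel_right]
  have htP : taylor (-(m : ℚ)) (principalPoly A B ε n K) =
      ∑ d ∈ range A, C (laurent A B ε n K d) * (X + C ((K : ℚ) - m)) ^ d := by
    rw [principalPoly, map_sum]
    refine Finset.sum_congr rfl fun d _ => ?_
    rw [taylor_mul, taylor_C, taylor_pow, map_add, taylor_X, taylor_C, C_neg, map_sub]; ring
  rw [taylor_mul, htK, htm, htP, Polynomial.coe_mul, Polynomial.coe_pow, Polynomial.coe_X,
    show (((∑ d ∈ range A, C (laurent A B ε n K d) * (X + C ((K : ℚ) - m)) ^ d : ℚ[X])) : PowerSeries ℚ) =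
      ∑ d ∈ range A, ((C (laurent A B ε n K d) * (X + C ((K : ℚ) - m)) ^ d : ℚ[X]) : PowerSeries ℚ)
      from map_sum (Polynomial.coeToPowerSeries.ringHom (R := ℚ))
        (fun d : ℕ => Polynomial.C (laurent A B ε n K d) * (X + Polynomial.C ((K : ℚ) - m)) ^ d) (range A)]
  rw [Finset.sum_mul, Finset.sum_mul, Finset.mul_sum]
  refine Finset.sum_congr rfl fun d _ => ?_
  rw [Polynomial.coe_mul, Polynomial.coe_C]
  ring

/-- `(T + c)^d · ((T + c)^A)^{−1} = ((T + c)^{A−d})^{−1}` for `d ≤ A` (`c ≠ 0`). -/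
theorem coe_pow_mul_inv_coe_pow {c : ℚ} (hc : c ≠ 0) {d A : ℕ} (hd : d ≤ A) :
    ((((X + C c) ^ d : ℚ[X])) : PowerSeries ℚ) * ((((X + C c) ^ A : ℚ[X]) : PowerSeries ℚ))⁻¹ =
      ((((X + C c) ^ (A - d) : ℚ[X]) : PowerSeries ℚ))⁻¹ := by
  have hne : ∀ e : ℕ, PowerSeries.constantCoeff ((((X + C c) ^ e : ℚ[X])) : PowerSeries ℚ) ≠ 0 := fun e => by
    rw [constantCoeff_coe_X_add_C_pow]; exact pow_ne_zero _ hc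
  rw [eq_comm, PowerSeries.inv_eq_iff_mul_eq_one (hne _), mul_right_comm, ← Polynomial.coe_mul, ← pow_add,
    Nat.add_sub_cancel' hd, PowerSeries.mul_inv_cancel _ (hne _)]

/-! ## The regular Taylor coefficients through the cells -/

/-- **`[T^{A+C}]F_m` THROUGH THE CELLS** (`2B ≤ A`, `ε < A`, `m ≤ n`, every `C ≥ 0`):
`laurent A B ε n m (A + C) = Σ_{K≤n, K≠m} Σ_{s∈[1,A]} c_{K,s}·(K−m)^{−s}·((−(K−m)^{−1})^C·binom(s−1+C, s−1))` — the Taylor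
coefficients of the regular part of `R_n` at `−m`, from the partial fractions of the other poles. -/
theorem laurent_regular_eq {A B : ℕ} (hAB : 2 * B ≤ A) {ε : ℕ} (hε : ε < A) {n m : ℕ} (hm : m ≤ n) (C : ℕ) :
    laurent A B ε n m (A + C) = ∑ K ∈ (range (n + 1)).erase m, ∑ s ∈ Icc 1 A,
      cell A B ε n K s * ((((K : ℚ) - m)⁻¹) ^ s * ((-((K : ℚ) - m)⁻¹) ^ C * (Nat.choose (s - 1 + C) (s - 1) : ℚ))) := by
  have hmr : m ∈ range (n + 1) := mem_range.2 (by omega)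
  rw [laurent, laurentSeries, kerNum_eq_sum hAB hε n, expandAt_finset_sum, map_sum, ← Finset.add_sum_erase _ _ hmr,
    expandAt_self_term, coeff_self_term, zero_add]
  refine Finset.sum_congr rfl fun K hK => ?_
  have hKm : K ≠ m := ne_of_mem_erase hK
  have hKn : K ≤ n := by have := mem_range.1 (mem_of_mem_erase hK); omega
  have hcK : ((K : ℚ) - m) ≠ 0 := sub_ne_zero.2 (by exact_mod_cast hKm)
  rw [expandAt_other_term A B ε hm hKn hKm, add_comm A C, PowerSeries.coeff_X_pow_mul, map_sum]
  -- reindex `d = A − s`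
  symm
  refine Finset.sum_nbij' (fun s => A - s) (fun d => A - d) (fun s hs => ?_) (fun d hd => ?_) (fun s hs => ?_)
    (fun d hd => ?_) (fun s hs => ?_)
  · have := mem_Icc.1 hs; exact mem_range.2 (by omega)
  · have := mem_range.1 hd; exact mem_Icc.2 ⟨by omega, by omega⟩
  · have := mem_Icc.1 hs; omega
  · have := mem_range.1 hd; omega
  · have hs' := mem_Icc.1 hs
    rw [PowerSeries.coeff_C_mul, coe_pow_mul_inv_coe_pow hcK (by omega : A - s ≤ A),
      show A - (A - s) = s by omega, coeff_inv_coe_X_add_C_pow hcK hs'.1, cell]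

/-- The same with the conventional binomial: **`[T^{A+C}]F_m = (−1)^C Σ_{K≠m} Σ_s binom(s+C−1, C)·c_{K,s}/(K−m)^{s+C}`**. -/
theorem laurent_regular_eq' {A B : ℕ} (hAB : 2 * B ≤ A) {ε : ℕ} (hε : ε < A) {n m : ℕ} (hm : m ≤ n) (C : ℕ) :
    laurent A B ε n m (A + C) = (-1) ^ C * ∑ K ∈ (range (n + 1)).erase m, ∑ s ∈ Icc 1 A,
      (Nat.choose (s + C - 1) C : ℚ) * cell A B ε n K s / ((K : ℚ) - m) ^ (s + C) := by
  rw [laurent_regular_eq hAB hε hm C, Finset.mul_sum]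
  refine Finset.sum_congr rfl fun K hK => ?_
  have hcK : ((K : ℚ) - m) ≠ 0 := sub_ne_zero.2 (by exact_mod_cast ne_of_mem_erase hK)
  rw [Finset.mul_sum]
  refine Finset.sum_congr rfl fun s hs => ?_
  have hs' := mem_Icc.1 hs
  have hch : (Nat.choose (s - 1 + C) (s - 1) : ℚ) = Nat.choose (s + C - 1) C := by
    rw [show s + C - 1 = s - 1 + C by omega, Nat.choose_symm_add]
  rw [hch, neg_pow, inv_pow, inv_pow, pow_add, div_eq_mul_inv, mul_inv]
  ring

end

end Summit.KontsevichZagierPeriods.Zeta5Search.BrickRegularCoefficients
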